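import Summits.RiemannHypothesis.RiemannHypothesis.Theorems.WeilFormatCShiftFormBound
import Summits.RiemannHypothesis.RiemannHypothesis.Theorems.WeilFormatCEntryIncrement
import Summits.RiemannHypothesis.RiemannHypothesis.Theorems.WeilFormatCWindowGram
import Literature.NumberTheory.LFunctions.YoshidaWindowGram
import HarnessLib

/-!
# Format C: the PRIME block of Yoshida's Gram matrix is `⪰ −A_op⁺·1` on every finite set of modes

Route context: Fourier–Galerkin / Schur-complement certificates of Weil positivity on a window ("format C";
cell memo `run/shared/lean/pub/rh-explicit/rh-explicit-weil-10/FORMATC-DESIGN.md` §4.3 PRIME, §0.4; supporting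
stmt-RiemannHypothesis-0098; seat rh-explicit-weil-10).  First ANALYTIC piece of the far-coercivity lemma L-C3a on the
actual kernel: for every finite set of modes `s ⊆ ℤ` and all complex coefficients `c`,

  `−A_op⁺(a) · Σ_{n∈s} |c_n|² ≤ Σ_{n,m∈s} Re(conj c_n · c_m) · primeCoeff a n m`,
  `A_op⁺(a) = Σ_{log k<2a} Λ(k) k^{−1/2} · 2cos(π/(⌊2a/log k⌋ + 2))`

(`Yoshida1992.primeCoeff`, `Literature/NumberTheory/LFunctions/YoshidaWindowGram.lean`, the prime part of Yoshida's
(5.15)/(5.16)).  The constant is uniform in `s` — this is what makes the bound usable on the FAR modes `|n| > M₁` of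
every truncation (hypothesis `hP` of `WeilFormatC.farBlock_ge_dhat`), and it is the certified `A_op⁺` of the format-C
pipeline (0.490 / 1.124 / 1.674 / 2.394 / 3.129 at `a = ½ / 0.59 / 0.72 / 0.9 / 1`, FORMATC-DESIGN §4.3) in place of
Yoshida's pointwise `A(μ) = 2ΣΛ_ℓ`.

Chain (all ingredients landed): weil-2's increment entry theorems (`WeilFormatCEntryIncrement.lean`:
`integral_incr_mul_conj_incr`, `integral_incr_mul_conj_incr_eq`) identify
`Σ Re(conj c_n c_m)(K_t(n,m) − 2δ_{nm}) = −2 Re ∫ f(x+t) conj f(x) dx`, `f = Σ c_n χ_n`, `0 ≤ t ≤ 2a`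
(`sum_sum_re_mul_incrCoeff_sub_two_eq`); the window shift bound `WeilFormatC.two_mul_abs_integral_shift_mul_le`
(`WeilFormatCShiftFormBound.lean`, path graph) applied to `Re f` and `Im f` gives
`2 Re ∫ f(x+t) conj f(x) ≤ 2cos(π/(N+1)) ‖f‖²` for any window function and `N t > 2a`
(`two_mul_re_integral_shift_mul_conj_le`); `‖Σ c_nχ_n‖² = Σ|c_n|²` (`integral_norm_sq_sum_smul_chi`).

Standard axioms; no definitions; no RH claim.
-/

set_option autoImplicit false
-- `Summit.RiemannHypothesis.RiemannHypothesis.…` is the layout-mandated namespace (summit = problem name).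
set_option linter.dupNamespace false

noncomputable section

open Complex Set MeasureTheory Finset
open scoped Real ComplexConjugate BigOperators ArithmeticFunction.vonMangoldt

namespace Summit.RiemannHypothesis.RiemannHypothesis.Theorems.WeilFormatC

open Literature.NumberTheory.LFunctions Literature.NumberTheory.LFunctions.Yoshida1992

/-! ## Real window functions: whole-line integrals as window integrals -/

section RealWindow

variable {g : ℝ → ℝ} {a C : ℝ}

/-- A bounded measurable real function vanishing off `[−a, a]`: products `g(x + t)·h(x)` with a bounded measurable
`h` vanishing off the window are integrable on `ℝ`. -/
theorem integrable_shift_mul_of_window {h : ℝ → ℝ} {D : ℝ} (hg : Measurable g) (hC : ∀ x, |g x| ≤ C)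
    (hh : Measurable h) (hD : ∀ x, |h x| ≤ D) (hsupp : ∀ x, x ∉ Icc (-a) a → h x = 0) (t : ℝ) :
    Integrable fun x ↦ g (x + t) * h x := by
  have hC0 : 0 ≤ C := le_trans (abs_nonneg _) (hC 0)
  have hint : Integrable fun x ↦ (Icc (-a) a).indicator (fun _ ↦ C * D) x :=
    (integrable_indicator_iff measurableSet_Icc).2 (integrableOn_const (by simp [Real.volume_Icc]))
  refine hint.mono' (((hg.comp (measurable_id.add_const t)).mul hh).aestronglyMeasurable)
    (Filter.Eventually.of_forall fun x ↦ ?_)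
  by_cases hx : x ∈ Icc (-a) a
  · rw [indicator_of_mem hx, Real.norm_eq_abs, abs_mul]
    exact mul_le_mul (hC _) (hD x) (abs_nonneg _) hC0
  · rw [hsupp x hx, indicator_of_notMem hx, mul_zero, norm_zero]

/-- For `h` vanishing off `[−a, a]` (`0 ≤ a`): `∫_ℝ h = ∫_{−a}^{a} h`. -/
theorem integral_eq_intervalIntegral_of_window {h : ℝ → ℝ} (ha : 0 ≤ a)
    (hsupp : ∀ x, x ∉ Icc (-a) a → h x = 0) : ∫ x, h x = ∫ x in (-a)..a, h x := by
  rw [intervalIntegral.integral_of_le (by linarith), ← integral_Icc_eq_integral_Ioc,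
    ← integral_indicator measurableSet_Icc]
  congr 1; ext x
  by_cases hx : x ∈ Icc (-a) a
  · rw [indicator_of_mem hx]
  · rw [indicator_of_notMem hx, hsupp x hx]

/-- The whole-line shifted product is the window inner product of the shift lemma:
`∫_ℝ g(x+t) g(x) dx = ∫_{−a}^{a} g(x − t) g(x) dx` for `g` vanishing off `[−a, a]`, `0 ≤ a`. -/
theorem integral_shift_mul_eq_intervalIntegral (ha : 0 ≤ a) (hsupp : ∀ x, x ∉ Icc (-a) a → g x = 0) (t : ℝ) :
    ∫ x, g (x + t) * g x = ∫ x in (-a)..a, g (x - t) * g x := by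
  have e1 : ∫ x, g (x + t) * g x = ∫ x, (fun y ↦ g (y - t) * g y) (x + t) := by
    congr 1; ext x; simp only [add_sub_cancel_right]; ring
  rw [e1, integral_add_right_eq_self (fun y ↦ g (y - t) * g y) t]
  exact integral_eq_intervalIntegral_of_window ha fun x hx ↦ by rw [hsupp x hx, mul_zero]

/-- **Whole-line form of the window shift bound** (`WeilFormatC.two_mul_abs_integral_shift_mul_le`): for a bounded
measurable real `g` vanishing off `[−a, a]` (`0 ≤ a`), `0 < t`, `N ≥ 1`, `2a < N t`:
`2 ∫_ℝ g(x+t) g(x) dx ≤ 2cos(π/(N+1)) ∫_ℝ g²`. -/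
theorem two_mul_integral_shift_mul_le (ha : 0 ≤ a) (hg : Measurable g) (hC : ∀ x, |g x| ≤ C)
    (hsupp : ∀ x, x ∉ Icc (-a) a → g x = 0) {t : ℝ} (ht : 0 < t) {N : ℕ} (hN1 : 1 ≤ N)
    (hN : 2 * a < N * t) :
    2 * ∫ x, g (x + t) * g x ≤ 2 * Real.cos (π / (N + 1)) * ∫ x, g x ^ 2 := by
  rw [integral_shift_mul_eq_intervalIntegral ha hsupp t,
    integral_eq_intervalIntegral_of_window ha (fun x hx ↦ by rw [hsupp x hx]; ring)]
  have h := two_mul_abs_integral_shift_mul_le hg hC hsupp ht hN1 hN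
  linarith [le_abs_self (∫ x in (-a)..a, g (x - t) * g x)]

end RealWindow

/-! ## Complex window functions: `2 Re ⟨f(·+t), f⟩ ≤ 2cos(π/(N+1)) ‖f‖²` -/

section ComplexWindow

variable {a : ℝ} {f : ℝ → ℂ}

/-- For a window function `f`, `x ↦ f(x+t) conj f(x)` is integrable. -/
theorem integrable_shift_mul_conj (hf : IsWindowFunction a f) (t : ℝ) :
    Integrable fun x ↦ f (x + t) * conj (f x) := by
  obtain ⟨S, hS0, hS⟩ := hf.bounded'
  have hint : Integrable fun x ↦ (Icc (-a) a).indicator (fun _ ↦ S * S) x :=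
    (integrable_indicator_iff measurableSet_Icc).2 (integrableOn_const (by simp [Real.volume_Icc]))
  refine hint.mono' (((hf.measurable.comp (measurable_id.add_const t)).mul
    (Complex.continuous_conj.measurable.comp hf.measurable)).aestronglyMeasurable)
    (Filter.Eventually.of_forall fun x ↦ ?_)
  by_cases hx : x ∈ Icc (-a) a
  · rw [indicator_of_mem hx, norm_mul, Complex.norm_conj]
    exact mul_le_mul (hS _) (hS x) (norm_nonneg _) hS0
  · rw [hf.eq_zero x hx, indicator_of_notMem hx, map_zero, mul_zero, norm_zero]

/-- `Re ∫ f(x+t) conj f(x) dx = ∫ (Re f(x+t) Re f(x) + Im f(x+t) Im f(x)) dx` for a window function. -/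
theorem re_integral_shift_mul_conj (hf : IsWindowFunction a f) (t : ℝ) :
    (∫ x, f (x + t) * conj (f x)).re
      = ∫ x, ((f (x + t)).re * (f x).re + (f (x + t)).im * (f x).im) := by
  have h := integral_re (integrable_shift_mul_conj hf t)
  simp only [RCLike.re_to_complex] at h
  rw [← h]
  congr 1; ext x
  simp only [Complex.mul_re, Complex.conj_re, Complex.conj_im]
  ring

/-- `‖f‖² = ∫ (Re f)² + ∫ (Im f)²` for a window function. -/
theorem integral_norm_sq_eq_add (hf : IsWindowFunction a f) :
    ∫ x, ‖f x‖ ^ 2 = (∫ x, (f x).re ^ 2) + ∫ x, (f x).im ^ 2 := by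
  obtain ⟨S, hS0, hS⟩ := hf.bounded'
  have hre : ∀ x, |(f x).re| ≤ S := fun x ↦ (Complex.abs_re_le_norm _).trans (hS x)
  have him : ∀ x, |(f x).im| ≤ S := fun x ↦ (Complex.abs_im_le_norm _).trans (hS x)
  have hmr : Measurable fun x ↦ (f x).re := Complex.measurable_re.comp hf.measurable
  have hmi : Measurable fun x ↦ (f x).im := Complex.measurable_im.comp hf.measurable
  have hzr : ∀ x, x ∉ Icc (-a) a → (f x).re = 0 := fun x hx ↦ by rw [hf.eq_zero x hx, Complex.zero_re]
  have hzi : ∀ x, x ∉ Icc (-a) a → (f x).im = 0 := fun x hx ↦ by rw [hf.eq_zero x hx, Complex.zero_im]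
  have i1 := integrable_shift_mul_of_window hmr hre hmr hre hzr 0
  have i2 := integrable_shift_mul_of_window hmi him hmi him hzi 0
  simp only [add_zero] at i1 i2
  have e : (fun x ↦ ‖f x‖ ^ 2) = fun x ↦ (f x).re * (f x).re + (f x).im * (f x).im := by
    ext x; rw [Complex.sq_norm, Complex.normSq_apply]
  rw [e, integral_add i1 i2]
  congr 1 <;> (congr 1; ext x; ring)

/-- **Shift bound for complex window functions.**  For a window function `f` on `[−a, a]` (`0 ≤ a`), `0 < t`,
`N ≥ 1` with `2a < N t`:  `2 Re ∫ f(x+t) conj f(x) dx ≤ 2cos(π/(N+1)) ∫ ‖f‖²`  — the path-graph (Perron) constant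
of `WeilFormatC.two_mul_abs_integral_shift_mul_le`, applied to `Re f` and `Im f`. -/
theorem two_mul_re_integral_shift_mul_conj_le (ha : 0 ≤ a) (hf : IsWindowFunction a f) {t : ℝ} (ht : 0 < t)
    {N : ℕ} (hN1 : 1 ≤ N) (hN : 2 * a < N * t) :
    2 * (∫ x, f (x + t) * conj (f x)).re ≤ 2 * Real.cos (π / (N + 1)) * ∫ x, ‖f x‖ ^ 2 := by
  obtain ⟨S, hS0, hS⟩ := hf.bounded'
  have hre : ∀ x, |(f x).re| ≤ S := fun x ↦ (Complex.abs_re_le_norm _).trans (hS x)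
  have him : ∀ x, |(f x).im| ≤ S := fun x ↦ (Complex.abs_im_le_norm _).trans (hS x)
  have hmr : Measurable fun x ↦ (f x).re := Complex.measurable_re.comp hf.measurable
  have hmi : Measurable fun x ↦ (f x).im := Complex.measurable_im.comp hf.measurable
  have hzr : ∀ x, x ∉ Icc (-a) a → (f x).re = 0 := fun x hx ↦ by rw [hf.eq_zero x hx, Complex.zero_re]
  have hzi : ∀ x, x ∉ Icc (-a) a → (f x).im = 0 := fun x hx ↦ by rw [hf.eq_zero x hx, Complex.zero_im]
  have i1 := integrable_shift_mul_of_window hmr hre hmr hre hzr t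
  have i2 := integrable_shift_mul_of_window hmi him hmi him hzi t
  rw [re_integral_shift_mul_conj hf t, integral_add i1 i2, integral_norm_sq_eq_add hf]
  have b1 := two_mul_integral_shift_mul_le (g := fun x ↦ (f x).re) ha hmr hre hzr ht hN1 hN
  have b2 := two_mul_integral_shift_mul_le (g := fun x ↦ (f x).im) ha hmi him hzi ht hN1 hN
  linarith

end ComplexWindow

/-! ## The prime block on trigonometric windows -/

section Prime

variable {a : ℝ}

/-- The shifted inner product of a trigonometric window, entrywise:
`∫ f(x+t) conj f(x) dx = Σ_n Σ_m conj(c_n) c_m ∫ χ_m(x+t) conj χ_n(x) dx`, `f = Σ c_n χ_n`, `t ≥ 0`. -/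
theorem integral_sum_smul_chi_shift_mul_conj (s : Finset ℤ) (c : ℤ → ℂ) {t : ℝ} (ht : 0 ≤ t) :
    ∫ x, (∑ n ∈ s, c n • chi a n) (x + t) * conj ((∑ n ∈ s, c n • chi a n) x)
      = ∑ n ∈ s, ∑ m ∈ s, conj (c n) * c m * ∫ x, chi a m (x + t) * conj (chi a n x) := by
  have hpt : ∀ x, (∑ n ∈ s, c n • chi a n) (x + t) * conj ((∑ n ∈ s, c n • chi a n) x)
      = ∑ n ∈ s, ∑ m ∈ s, conj (c n) * c m * (chi a m (x + t) * conj (chi a n x)) := by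
    intro x
    rw [sum_smul_chi_apply, sum_smul_chi_apply, map_sum, Finset.sum_mul_sum, Finset.sum_comm]
    refine Finset.sum_congr rfl fun n _ ↦ Finset.sum_congr rfl fun m _ ↦ ?_
    rw [map_mul]; ring
  simp_rw [hpt]
  have hint : ∀ n m : ℤ, Integrable fun x ↦ conj (c n) * c m * (chi a m (x + t) * conj (chi a n x)) :=
    fun n m ↦ (integrable_chi_shift_mul_conj_chi m n ht).const_mul _
  rw [integral_finsetSum _ fun n _ ↦ integrable_finsetSum _ fun m _ ↦ hint n m]
  refine Finset.sum_congr rfl fun n _ ↦ ?_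
  rw [integral_finsetSum _ fun m _ ↦ hint n m]
  refine Finset.sum_congr rfl fun m _ ↦ ?_
  rw [integral_const_mul]

/-- **The increment kernel minus `2δ` is minus twice the shifted inner product.**  For `0 ≤ t ≤ 2a` and
`f = Σ_{n∈s} c_n χ_n`:
`Σ_n Σ_m Re(conj c_n c_m)·(K_t(n,m) − 2δ_{nm}) = −2 Re ∫ f(x+t) conj f(x) dx`, with Yoshida's increment kernel
`K_t = Yoshida1992.incrCoeff a t` ((5.2)/(5.3) integrated; weil-2's `integral_incr_mul_conj_incr_eq`). -/
theorem sum_sum_re_mul_incrCoeff_sub_two_eq (ha : 0 < a) (s : Finset ℤ) (c : ℤ → ℂ) {t : ℝ} (ht0 : 0 ≤ t)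
    (ht : t ≤ 2 * a) :
    ∑ n ∈ s, ∑ m ∈ s, (conj (c n) * c m).re * (incrCoeff a t n m - if n = m then 2 else 0)
      = -2 * (∫ x, (∑ n ∈ s, c n • chi a n) (x + t) * conj ((∑ n ∈ s, c n • chi a n) x)).re := by
  -- entrywise: `↑(K_t(n,m) − 2δ) = −I(m,n) − conj I(n,m)`
  set I : ℤ → ℤ → ℂ := fun m n ↦ ∫ x, chi a m (x + t) * conj (chi a n x) with hI
  have hentry : ∀ n m : ℤ, ((incrCoeff a t n m - if n = m then 2 else 0 : ℝ) : ℂ) = -I m n - conj (I n m) := by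
    intro n m
    have h1 := integral_incr_mul_conj_incr ha m n ht0
    have h2 := integral_incr_mul_conj_incr_eq ha m n ht0 ht
    have hK : ((incrCoeff a t n m : ℝ) : ℂ) = 2 * (if m = n then 1 else 0) - I m n - conj (I n m) := by
      rw [← h1, h2]
      unfold incrCoeff freq
      rfl
    rw [Complex.ofReal_sub, hK]
    by_cases hnm : n = m
    · subst hnm
      simp only [if_true, Complex.ofReal_ofNat]
      ring
    · rw [if_neg hnm, if_neg (Ne.symm hnm), Complex.ofReal_zero]
      ring
  -- sum: `Σ conj(c_n) c_m ↑(K − 2δ) = −J − conj J`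
  set J : ℂ := ∫ x, (∑ n ∈ s, c n • chi a n) (x + t) * conj ((∑ n ∈ s, c n • chi a n) x) with hJ
  have hJsum : J = ∑ n ∈ s, ∑ m ∈ s, conj (c n) * c m * I m n := by
    rw [hJ, integral_sum_smul_chi_shift_mul_conj s c ht0]
  have hJconj : conj J = ∑ n ∈ s, ∑ m ∈ s, conj (c n) * c m * conj (I n m) := by
    rw [hJsum, map_sum, Finset.sum_comm]
    refine Finset.sum_congr rfl fun n _ ↦ ?_
    rw [map_sum]
    refine Finset.sum_congr rfl fun m _ ↦ ?_
    rw [map_mul, map_mul, Complex.conj_conj]; ring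
  have hC : (∑ n ∈ s, ∑ m ∈ s, conj (c n) * c m * ((incrCoeff a t n m - if n = m then 2 else 0 : ℝ) : ℂ))
      = -J - conj J := by
    simp_rw [hentry]
    rw [hJconj, hJsum]
    simp only [mul_sub, mul_neg, Finset.sum_sub_distrib, Finset.sum_neg_distrib]
  -- real parts
  have hre : (∑ n ∈ s, ∑ m ∈ s, conj (c n) * c m * ((incrCoeff a t n m - if n = m then 2 else 0 : ℝ) : ℂ)).re
      = ∑ n ∈ s, ∑ m ∈ s, (conj (c n) * c m).re * (incrCoeff a t n m - if n = m then 2 else 0) := by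
    rw [Complex.re_sum]
    refine Finset.sum_congr rfl fun n _ ↦ ?_
    rw [Complex.re_sum]
    refine Finset.sum_congr rfl fun m _ ↦ ?_
    rw [Complex.re_mul_ofReal]
  rw [← hre, hC]
  simp only [Complex.sub_re, Complex.neg_re, Complex.conj_re]
  ring

/-- **The prime form on a trigonometric window, length by length.**  For `k` with `log k < 2a` and
`f = Σ_{n∈s} c_nχ_n`:
`Λ(k)k^{−1/2}·Σ_nΣ_m Re(conj c_n c_m)(K_{log k}(n,m) − 2δ_{nm}) ≥ −Λ(k)k^{−1/2}·2cos(π/(⌊2a/log k⌋+2))·Σ|c_n|²`. -/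
theorem vonMangoldt_mul_incr_form_ge (ha : 0 < a) (s : Finset ℤ) (c : ℤ → ℂ) {k : ℕ}
    (hk : k ∈ weilPrimeIndex a) :
    -((Λ k : ℝ) / Real.sqrt k * (2 * Real.cos (π / (⌊2 * a / Real.log k⌋₊ + 2))) * ∑ n ∈ s, ‖c n‖ ^ 2)
      ≤ (Λ k : ℝ) / Real.sqrt k *
        ∑ n ∈ s, ∑ m ∈ s, (conj (c n) * c m).re * (incrCoeff a (Real.log k) n m - if n = m then 2 else 0) := by
  by_cases hΛ : (Λ k : ℝ) = 0
  · rw [hΛ]; simp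
  -- `Λ k ≠ 0` forces `k ≥ 2`, so `t = log k > 0`
  have hk2 : 2 ≤ k := by
    by_contra h
    have : k = 0 ∨ k = 1 := by omega
    rcases this with rfl | rfl
    · exact hΛ (by simp)
    · exact hΛ (by simp)
  have ht : 0 < Real.log k := Real.log_pos (by exact_mod_cast hk2)
  have ht2 : Real.log k ≤ 2 * a := (mem_weilPrimeIndex.1 hk).le
  have hw : 0 ≤ (Λ k : ℝ) / Real.sqrt k :=
    div_nonneg ArithmeticFunction.vonMangoldt_nonneg (Real.sqrt_nonneg _)
  set N : ℕ := ⌊2 * a / Real.log k⌋₊ + 1 with hN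
  have hN1 : 1 ≤ N := by omega
  have hNt : 2 * a < N * Real.log k := by
    have h := Nat.lt_floor_add_one (2 * a / Real.log k)
    rw [div_lt_iff₀ ht] at h
    exact_mod_cast h
  have hf : IsWindowFunction a (∑ n ∈ s, c n • chi a n) :=
    IsWindowFunction.sum s c fun n _ ↦ isWindowFunction_chi ha n
  have hb := two_mul_re_integral_shift_mul_conj_le ha.le hf ht hN1 hNt
  rw [integral_norm_sq_sum_smul_chi ha s c] at hb
  have hcast : ((N : ℝ) + 1) = (⌊2 * a / Real.log k⌋₊ : ℝ) + 2 := by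
    rw [hN]; push_cast; ring
  rw [hcast] at hb
  rw [sum_sum_re_mul_incrCoeff_sub_two_eq ha s c ht.le ht2]
  have key : -(2 * Real.cos (π / (⌊2 * a / Real.log k⌋₊ + 2)) * ∑ n ∈ s, ‖c n‖ ^ 2)
      ≤ -2 * (∫ x, (∑ n ∈ s, c n • chi a n) (x + Real.log k) * conj ((∑ n ∈ s, c n • chi a n) x)).re := by
    linarith
  have := mul_le_mul_of_nonneg_left key hw
  linarith

/-- **PRIME ⪰ −A_op⁺·1 on every finite set of modes.**  For `a > 0`, every finite `s ⊆ ℤ` and all `c : ℤ → ℂ`: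
`−A_op⁺(a)·Σ_{n∈s}|c_n|² ≤ Σ_{n,m∈s} Re(conj c_n c_m)·primeCoeff a n m` with
`A_op⁺(a) = Σ_{k ∈ weilPrimeIndex a} Λ(k)k^{−1/2}·2cos(π/(⌊2a/log k⌋ + 2))` (FORMATC-DESIGN §4.3: the path-graph
constant, `N_k = ⌊2a/log k⌋ + 1` points `x, x+ℓ, …` fit in the window).  Uniform in `s`: on real even / odd
vectors supported on far modes this is hypothesis `hP` of `WeilFormatC.farBlock_ge_dhat` for the sector kernels. -/
theorem primeCoeff_form_ge (ha : 0 < a) (s : Finset ℤ) (c : ℤ → ℂ) :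
    -((∑ k ∈ weilPrimeIndex a, (Λ k : ℝ) / Real.sqrt k * (2 * Real.cos (π / (⌊2 * a / Real.log k⌋₊ + 2)))) *
        ∑ n ∈ s, ‖c n‖ ^ 2)
      ≤ ∑ n ∈ s, ∑ m ∈ s, (conj (c n) * c m).re * primeCoeff a n m := by
  -- rewrite the right side as a sum over lengths
  have e : ∑ n ∈ s, ∑ m ∈ s, (conj (c n) * c m).re * primeCoeff a n m
      = ∑ k ∈ weilPrimeIndex a, (Λ k : ℝ) / Real.sqrt k *
          ∑ n ∈ s, ∑ m ∈ s, (conj (c n) * c m).re * (incrCoeff a (Real.log k) n m - if n = m then 2 else 0) := by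
    calc ∑ n ∈ s, ∑ m ∈ s, (conj (c n) * c m).re * primeCoeff a n m
        = ∑ n ∈ s, ∑ m ∈ s, ∑ k ∈ weilPrimeIndex a, (Λ k : ℝ) / Real.sqrt k *
            ((conj (c n) * c m).re * (incrCoeff a (Real.log k) n m - if n = m then 2 else 0)) := by
          refine Finset.sum_congr rfl fun n _ ↦ Finset.sum_congr rfl fun m _ ↦ ?_
          rw [primeCoeff, Finset.mul_sum]
          refine Finset.sum_congr rfl fun k _ ↦ by ring
      _ = ∑ n ∈ s, ∑ k ∈ weilPrimeIndex a, ∑ m ∈ s, (Λ k : ℝ) / Real.sqrt k *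
            ((conj (c n) * c m).re * (incrCoeff a (Real.log k) n m - if n = m then 2 else 0)) :=
          Finset.sum_congr rfl fun n _ ↦ Finset.sum_comm
      _ = ∑ k ∈ weilPrimeIndex a, ∑ n ∈ s, ∑ m ∈ s, (Λ k : ℝ) / Real.sqrt k *
            ((conj (c n) * c m).re * (incrCoeff a (Real.log k) n m - if n = m then 2 else 0)) :=
          Finset.sum_comm
      _ = _ := by
          refine Finset.sum_congr rfl fun k _ ↦ ?_
          rw [Finset.mul_sum]
          refine Finset.sum_congr rfl fun n _ ↦ ?_
          rw [Finset.mul_sum]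
  rw [e, Finset.sum_mul, ← Finset.sum_neg_distrib]
  exact Finset.sum_le_sum fun k hk ↦ vonMangoldt_mul_incr_form_ge ha s c hk

end Prime

end Summit.RiemannHypothesis.RiemannHypothesis.Theorems.WeilFormatC

end
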